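import Summits.BirchSwinnertonDyer.BirchSwinnertonDyer.Theorems.GenusKolyvaginAtTwoKramerParityOfTwist
import Literature.NumberTheory.EllipticCurves.PoonenRainsTransport
import HarnessLib

/-!
# Route `GenusKolyvaginAtTwo`, crux #2 `GenusPrimitiveSupplyAtTwo` (stmt-BirchSwinnertonDyer-22136):
# KRAMER PARITY VIA QUADRATIC SELMER STRUCTURES, part 8 — (Q4) WIRED from the transport of the Poonen–Rains form:
# `MazurRubin2010.kramerParity K` follows from the GEOMETRIC FRAME DATUM of the quadratic twist alone

Width seat `bsd-line-gk2-p4` g12 (cell `bsd-f1-sign2`), sequel of part 7 (`…KramerParityOfTwist`, p648803). THEOREMS ONLY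
(no definition, no named fact, no `sorry`); helper `--supports stmt-BirchSwinnertonDyer-22136`; no item is closed; BSD is not
proved by any of this.

Part 7 reduced `MazurRubin2010.kramerParity K` (Kramer 1981 Thm. 1 = Mazur–Rubin 2010 Thm. 2.7 at `p = 2`, every number field)
to the single displayed hypothesis (Q4) TWIST COMPATIBILITY of the Poonen–Rains form `q_{W,v} = can_v ∘ prClass W K_v`:
`q_{W,v}` vanishes on the transported Kummer condition `φ_* 𝓚_{W',v}` of any model `W'` of `E^{(d)}` under THE identification
`φ : E^{(d)}[2] = E[2]` (Klagsbrun–Mazur–Rubin 2013, Lemma 5.2). The lead's `ThetaLevelTwo.prClass_map_eq`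
(`Literature/…/PoonenRainsTransport.lean`) proves the transport law `q_{W,L}(H¹(f) x') = q_{W',L}(x')` for every equivariant
`f : E'[2] → E[2]` carrying a FRAME DATUM: an index map `π` with `f(T'_j) = T_{πj}` and an affine relation of the `2`-torsion
abscissae `x'_i − x'_j = A (x_{πi} − x_{πj})`, `A ∈ K`. This file wires the two:

* §1 `canonical_prClass_eq_zero_of_mem_map_of_frame` — (Q4) AT ONE PLACE for an identification `φ` that carries a frame datum:
  transport law + (Q2) Kummer isotropy for `W'` (part 7 `tateQuadraticForm_prClass_Q2`);
* §2 `hQ4_of_twistFrame` — (Q4) VERBATIM (binders of `kramerParity`) from the GEOMETRIC FRAME DATUM of the twist: SOME injective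
  intertwining `f : W'[2] → W[2]` with a frame datum (by `huniq`, `f = φ` pointwise, so `φ` inherits the datum);
  **`kramerParity_of_twistFrame`** — `MazurRubin2010.kramerParity K` from that datum ALONE:
  `(∀ W d, d ∉ K² → ∀ W', (∃ C, C • W' = W^{(d)}) → ∃ f π A, Injective f ∧ (∀ j, f T'_j = T_{πj}) ∧ (∀ i j, x'_i − x'_j = A(x_{πi} − x_{πj})))`
  `→ kramerParity K`. For a twist model `C • W' = W^{(d)}` the datum is the untwisting over `K(√d)` restricted to `2`-torsion
  (`x' = u²d·x + r`, `A = u²d`; Silverman X.5.4) — the lead's "explicit geometric φ₀", not constructed here.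

Honest framing: CONDITIONAL reduction (the frame datum of the twist is displayed, not proved); KMR 2013 Lemma 5.2 bookkeeping;
closes nothing; crux 22136 stays OPEN at (U) ∧ (CONV₂); BSD is not proved by any of this.

References: [KlagsbrunMazurRubin2013] Lemma 5.2, Thm. 3.9; [MazurRubin2010] Thm. 2.7, Remark 2.4; [PoonenRains2012] §4.1,
Prop. 4.8; [SilvermanAEC2009] X.5 Cor. 5.4; [Kramer1981] Thm. 1.
-/

set_option linter.dupNamespace false -- tree convention: `Summit.BirchSwinnertonDyer.BirchSwinnertonDyer.Theorems` (summit = sub-problem)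
set_option autoImplicit false

noncomputable section

open scoped Classical ContRepresentation

namespace Summit.BirchSwinnertonDyer.BirchSwinnertonDyer.Theorems.GenusKolyKramer

open WeierstrassCurve Field NumberField
open Literature.NumberTheory.EllipticCurves Literature.NumberTheory.EllipticCurves.ThetaLevelTwo
open Literature.NumberTheory.EllipticCurves.DokchitserDokchitser2012 (T xT)
open Literature.NumberTheory.GaloisRepresentations
open Literature.NumberTheory.GaloisRepresentations.DiscreteGaloisModule (SelmerStructure)
open Literature.NumberTheory.GaloisCohomology

variable {K : Type} [Field K] [NumberField K]

/-! ## §1 (Q4) at one place for an identification carrying a frame datum -/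

/-- **(Q4) AT ONE PLACE from a frame datum.** For elliptic `W, W'` over a number field `K`, an intertwining
`φ : W'[2] → W[2]` (X11b currency, level `((2 : ℕ) : ℤ)`) with a FRAME DATUM — `φ(T'_j) = T_{πj}` and
`x'_i − x'_j = A·(x_{πi} − x_{πj})` with `A ∈ K` — and any local class `x` in the transported Kummer condition
`φ_* 𝓚_{W',v} ≤ H¹(K_v, E[2])`: `can_v (prClass W K_v x) = 0`. Proof: `x = H¹(φ_v) x'` with `x' ∈ 𝓚_{W',v}`; the lead's
transport law `prClass W K_v (H¹(φ_v) x') = prClass W' K_v x'` (`ThetaLevelTwo.prClass_map_eq`) and (Q2) for `W'`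
(`tateQuadraticForm_prClass_Q2`). [cite: KlagsbrunMazurRubin2013, Lemma 5.2 (α_v(χ) ∈ H(q_v))] [cite: PoonenRains2012, Prop. 4.8] -/
theorem canonical_prClass_eq_zero_of_mem_map_of_frame
    (W W' : WeierstrassCurve K) [W.IsElliptic] [W'.IsElliptic] (h2 : (2 : K) ≠ 0)
    (φ : (W'.torsionGaloisModule ((2 : ℕ) : ℤ)).toContRepresentation →ⁱL
      (W.torsionGaloisModule ((2 : ℕ) : ℤ)).toContRepresentation)
    (π : Fin 3 → Fin 3)
    (hπ : ∀ j, (show (W'.torsionGaloisModule 2).toContRepresentation →ⁱL (W.torsionGaloisModule 2).toContRepresentation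
      from φ) (T W' h2 j) = T W h2 (π j))
    (A : K) (hA : ∀ i j, xT W' h2 i - xT W' h2 j
      = algebraMap K (AlgebraicClosure K) A * (xT W h2 (π i) - xT W h2 (π j)))
    (v : Place K) (x : galoisCohomology ((W.torsionGaloisModule ((2 : ℕ) : ℤ)).toLocal v) 1)
    (hx : x ∈ (W'.kummerSelmerStructure ((2 : ℕ) : ℤ) v).map
      (galoisCohomology.map (φ.restrictField (Place.Completion v)) 1)) :
    LocalInvariants.canonical K 2 v (prClass W h2 (Place.Completion v)
      (show galoisCohomology ((W.torsionGaloisModule (2 : ℤ)).toLocal v) 1 from x)) = 0 := by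
  obtain ⟨x', hx', rfl⟩ := hx
  -- (Q2) for `W'` at `v`
  have hQ2 := tateQuadraticForm_prClass_Q2 W' h2 (LocalInvariants.canonical K 2) v x' hx'
  dsimp only at hQ2
  -- the transport law for `φ` (level `(2 : ℤ)` spelling of the lead's file)
  have key := prClass_map_eq W W' h2
    (show (W'.torsionGaloisModule 2).toContRepresentation →ⁱL (W.torsionGaloisModule 2).toContRepresentation from φ)
    π hπ A hA (Place.Completion v)
    (show galoisCohomology (GaloisRep.restrictField (Place.Completion v) (W'.torsionGaloisModule 2)) 1 from x')
  have key' : prClass W h2 (Place.Completion v)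
      (show galoisCohomology ((W.torsionGaloisModule (2 : ℤ)).toLocal v) 1 from
        galoisCohomology.map (φ.restrictField (Place.Completion v)) 1 x')
      = prClass W' h2 (Place.Completion v)
        (show galoisCohomology ((W'.torsionGaloisModule (2 : ℤ)).toLocal v) 1 from x') := key
  rw [key']
  exact hQ2

/-! ## §2 (Q4) verbatim, and Kramer parity, from the geometric frame datum of the twist -/

/-- **(Q4) VERBATIM from the geometric frame datum.** Binders as in `MazurRubin2010.kramerParity` / part 7's `hQ4`: for
`W`, a non-square `d`, a model `W'` with `C • W' = W^{(d)}`, THE identification `φ` (injective, `huniq`), `𝓐_v = φ_* 𝓚_{W',v}`;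
hypothesis: SOME injective intertwining `f : W'[2] → W[2]` with a frame datum `(π, A)`. By `huniq`, `f = φ` pointwise, so `φ`
carries the datum and §1 applies. [cite: KlagsbrunMazurRubin2013, Lemma 5.2] [cite: MazurRubin2010, Remark 2.4 (the identification E^F[2] = E[2])] -/
theorem hQ4_of_twistFrame (W : WeierstrassCurve K) [W.IsElliptic] (W' : WeierstrassCurve K) [W'.IsElliptic]
    (h2 : (2 : K) ≠ 0)
    (hgeo : ∃ (f : (W'.torsionGaloisModule 2).toContRepresentation →ⁱL (W.torsionGaloisModule 2).toContRepresentation)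
      (π : Fin 3 → Fin 3) (A : K), Function.Injective f ∧ (∀ j, f (T W' h2 j) = T W h2 (π j)) ∧
      (∀ i j, xT W' h2 i - xT W' h2 j = algebraMap K (AlgebraicClosure K) A * (xT W h2 (π i) - xT W h2 (π j))))
    (φ : (W'.torsionGaloisModule ((2 : ℕ) : ℤ)).toContRepresentation →ⁱL
      (W.torsionGaloisModule ((2 : ℕ) : ℤ)).toContRepresentation)
    (huniq : ∀ φ' : (W'.torsionGaloisModule ((2 : ℕ) : ℤ)).toContRepresentation →ⁱL
        (W.torsionGaloisModule ((2 : ℕ) : ℤ)).toContRepresentation,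
      Function.Injective φ' → ∀ a, φ' a = φ a)
    (𝓐 : SelmerStructure (W.torsionGaloisModule ((2 : ℕ) : ℤ)))
    (h𝓐 : ∀ v, 𝓐 v = (W'.kummerSelmerStructure ((2 : ℕ) : ℤ) v).map
      (galoisCohomology.map (φ.restrictField (Place.Completion v)) 1))
    (v : Place K) (x : galoisCohomology ((W.torsionGaloisModule ((2 : ℕ) : ℤ)).toLocal v) 1) (hx : x ∈ 𝓐 v) :
    LocalInvariants.canonical K 2 v (prClass W h2 (Place.Completion v)
      (show galoisCohomology ((W.torsionGaloisModule (2 : ℤ)).toLocal v) 1 from x)) = 0 := by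
  obtain ⟨f, π, A, hf, hπ, hA⟩ := hgeo
  have hfφ : ∀ a, f a = φ a :=
    huniq (show (W'.torsionGaloisModule ((2 : ℕ) : ℤ)).toContRepresentation →ⁱL
      (W.torsionGaloisModule ((2 : ℕ) : ℤ)).toContRepresentation from f) hf
  have hπφ : ∀ j, (show (W'.torsionGaloisModule 2).toContRepresentation →ⁱL (W.torsionGaloisModule 2).toContRepresentation
      from φ) (T W' h2 j) = T W h2 (π j) := fun j => by
    rw [← hπ j]
    exact (hfφ (T W' h2 j)).symm
  rw [h𝓐] at hx
  exact canonical_prClass_eq_zero_of_mem_map_of_frame W W' h2 φ π hπφ A hA v x hx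

/-- **KRAMER PARITY FROM THE GEOMETRIC FRAME DATUM OF THE QUADRATIC TWIST ALONE** (`MazurRubin2010.kramerParity K`, every
number field `K`; Kramer 1981 Thm. 1 = Mazur–Rubin 2010 Thm. 2.7 at `p = 2`). Displayed hypothesis: for every elliptic `W`,
non-square `d` and model `W'` of the twist (`C • W' = W.quadraticTwist d`) there is SOME injective intertwining
`f : W'[2] → W[2]` matching the `2`-torsion frames (`f T'_j = T_{πj}`) with affinely related abscissae
(`x'_i − x'_j = A (x_{πi} − x_{πj})`, `A ∈ K`) — the restriction to `2`-torsion of the untwisting isomorphism over `K(√d)`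
(`x' = u²d·x + r`). Everything else (KMR Thm. 3.9 on `H¹(K, E[2])`, PT with real places, Tate χ, Kummer self-duality,
(Q1) polar form, (Q2) isotropy, (Q3) reciprocity, the transport law) is a tree theorem (parts 1–7, the lead's Poonen–Rains files).
[cite: MazurRubin2010, Thm. 2.7] [cite: KlagsbrunMazurRubin2013, Thm. 3.9 and Lemma 5.2] [cite: SilvermanAEC2009, X.5 Cor. 5.4] -/
theorem kramerParity_of_twistFrame
    (hgeo : ∀ (W : WeierstrassCurve K) [W.IsElliptic] (d : K), (∀ x : K, x ^ 2 ≠ d) →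
      ∀ (W' : WeierstrassCurve K) [W'.IsElliptic], (∃ C : VariableChange K, C • W' = W.quadraticTwist d) →
      ∃ (f : (W'.torsionGaloisModule 2).toContRepresentation →ⁱL (W.torsionGaloisModule 2).toContRepresentation)
        (π : Fin 3 → Fin 3) (A : K), Function.Injective f ∧
        (∀ j, f (T W' (two_ne_zero (α := K)) j) = T W (two_ne_zero (α := K)) (π j)) ∧
        (∀ i j, xT W' (two_ne_zero (α := K)) i - xT W' (two_ne_zero (α := K)) j
          = algebraMap K (AlgebraicClosure K) A
            * (xT W (two_ne_zero (α := K)) (π i) - xT W (two_ne_zero (α := K)) (π j)))) :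
    MazurRubin2010.kramerParity K :=
  kramerParity_of_prClass_twist fun W _ d hd W' _ hC φ _ huniq 𝓐 h𝓐 v x hx =>
    hQ4_of_twistFrame W W' two_ne_zero (hgeo W d hd W' hC) φ huniq 𝓐 h𝓐 v x hx

end Summit.BirchSwinnertonDyer.BirchSwinnertonDyer.Theorems.GenusKolyKramer

end
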